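import Summits.AnomalousDissipation.AnomalousDissipation.Theorems.SolenoidalFractalHomogenisationLagrangianCarrierConstructionFlowsLRegular
import HarnessLib

/-!
# K3L `LagrangianCarrierConstruction` (stmt-AnomalousDissipation-24913), line `birth`: the registered stub `stub_flowsL` (skeleton r23 v6)
# (`--supports stmt-AnomalousDissipation-24913`)

Summits-side file (everything proved; no definitions, no named facts). `stub_flowsL` is, VERBATIM, the stub of the planner's skeleton
`Cruxes.LagrangianCarrierConstruction.Birth` r23 v6 (sha16 6addedf3efd36bcb, re-cut after the refutation `…Negative.StubFlowsLFalse.stub_flowsL_false`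
of the r22/r23-v5 text): over every Lagrangian lattice carrier datum with `Permissible` bookkeeping (unused) and commensurable refresh windows
(W1), (W2) there are level fields and Lagrangian displacements with the same bookkeeping satisfying `IsLagrangian` and the eleven qualitative
clauses of `LevelRegular` other than pointwise summability: (L1) joint continuity, (L2) weak divergence-freeness, (L3a) spatial smoothness,
(L3b) space-derivative bounds uniform in time, (L4) time periodicity of every level field; (F1a) joint continuity, (F1b) smoothness, (F1c)
window-wise derivative bounds of every displacement; (F2a) `X m s s = id`, (F2b) the group law, (F2c) volume preservation. It is
`…FlowsLRegular.exists_isLagrangian_levelRegular'` (the Lagrangian tower `…TowerData.exists_tower` descended to the torus). Construction side of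
route-1's rung leaf F-D1.A0 — a frontier FORMAL rung; this is NOT a proof of anomalous dissipation, which is not claimed anywhere in this chain.
-/

set_option linter.dupNamespace false

noncomputable section

namespace Summit.AnomalousDissipation.AnomalousDissipation.Theorems.SolenoidalFractalHomogenisation.LagrangianCarrierConstruction

/-- **Registered stub `stub_flowsL` (K3L skeleton r23 v6): the Lagrangian insertion with all qualitative level / flow regularity.**
[cite: ArmstrongVicol2025, §2.2 (PDF pp. 12, 18: b_m = b_{m−1} + Σ_l 𝟙 v_m(t, X_{m−1}^{-1}(t,x,lτ″_m)); the flows X_m, smooth and measure preserving)] -/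
theorem stub_flowsL : ∀ k (E : Literature.Analysis.FluidPDE.LatticeShear.LagrangianLatticeCarrier k), E.toFractalCarrierData.Permissible → (∀ m, ∃ r : ℕ, 0 < r ∧ E.refresh (m + 1) = (r : ℝ) * E.toFractalCarrierData.physPeriod (m + 1)) → (∀ m, ∃ q : ℕ, 0 < q ∧ E.refresh m = (q : ℝ) * E.refresh (m + 1)) → ∃ E' : Literature.Analysis.FluidPDE.LatticeShear.LagrangianLatticeCarrier k, E'.toFractalCarrierData = E.toFractalCarrierData ∧ E'.refresh = E.refresh ∧ E'.θ = E.θ ∧ E'.IsLagrangian ∧ (∀ m, Continuous (Function.uncurry (E'.b (m + 1)))) ∧ (∀ m t, Literature.Analysis.FunctionSpaces.Torus.IsWeaklyDivFree (E'.b (m + 1) t)) ∧ (∀ m t, Literature.Analysis.FunctionSpaces.Torus.IsSmooth (E'.b (m + 1) t)) ∧ (∀ m (n : ℕ), ∃ C : ℝ, ∀ t y, ‖iteratedFDeriv ℝ n (Literature.Analysis.FunctionSpaces.Torus.lift (E'.b (m + 1) t)) y‖ ≤ C) ∧ (∀ m, ∃ τ : ℝ, 0 < τ ∧ Function.Periodic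 (E'.b (m + 1)) τ) ∧ (∀ m s, Continuous fun p : ℝ × UnitAddTorus (Fin 3) => E'.disp m p.1 s p.2) ∧ (∀ m t s, Literature.Analysis.FunctionSpaces.Torus.IsSmooth (E'.disp m t s)) ∧ (∀ m (n : ℕ) (j : ℤ), ∃ C : ℝ, ∀ t ∈ E'.window (m + 1) j, ∀ y, ‖iteratedFDeriv ℝ n (Literature.Analysis.FunctionSpaces.Torus.lift (E'.disp m t ((j : ℝ) * E'.refresh (m + 1)))) y‖ ≤ C) ∧ (∀ m s, E'.X m s s = id) ∧ (∀ m t s r, E'.X m t s ∘ E'.X m s r = E'.X m t r) ∧ (∀ m t s, MeasureTheory.MeasurePreserving (E'.X m t s) MeasureTheory.volume MeasureTheory.volume) :=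
  fun k E _ hW1 hW2 => exists_isLagrangian_levelRegular' k E hW1 hW2

end Summit.AnomalousDissipation.AnomalousDissipation.Theorems.SolenoidalFractalHomogenisation.LagrangianCarrierConstruction

end
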